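import Summits.QuantumFields.BalabanUV.Beta.GAN24.FibInvClosedForm

/-!
# `BalabanUV.Beta.GAN24.FineReadoutColumn` — binder row G-an2-4 / (CONV-C), S-slot located remainder «E3Shape», route «S3-fibre²»
# (gan24-p1 `SKELETON-S3.md` v0.2, S3-L3(a) «the fine minimiser column symbol ĥ_N(k)», node E3A1 of `E3A-READOUT.md` §3):
# THE MINIMISER COLUMN OF THE INVERSE BLOCH FIBRE AT A COMPLEX QUASI-MOMENTUM, EXPLICIT ALIAS BY ALIAS

NOT IN PRINT; OUR PROOF ATTEMPT (of the road; THIS file is [folklore] finite-dimensional algebra: an IDENTIFICATION — leaf-05's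
`FibInvClosedForm` §4 (stated there at REAL quasi-momentum, where an2's bijectivity supplies the inverse) re-read at ANY complex `p`
at which the fibre determinant is nonzero, e.g. on road P1's strip by (U1) `FibreDetStripHolds.exists_detStrip`; no estimate, no
cited fact, no wall binder, no `def … : Prop`).  HONEST FRAMING (cell contract, verbatim): «discharging `BetaPertH` makes Bałaban's UV
stability UNCONDITIONAL — a real constructive-QFT result; it is NOT the continuum limit and NOT the Clay problem.»  HONEST DEPENDENCY
(verbatim): «continuum YM on T⁴ ⇐ BetaPertH ∧ nine spine estimates (0/9 proved); BetaPertH ⇐ (D1) ∧ (D4) ∧ CAP+tail; G-an2-4 gates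
asym, D1 and NE2/3/4.»  Discharges NOTHING of (hS, hSall) / «E3Shape»; NOT `BetaPertH`, NOT continuum, NOT Clay.

## What is proved (generic `d`, block side `N ≥ 1`, COMPLEX quasi-momentum `p`)
* `fibreFun_fibInvCol_of_det`: if `det F_N(p) ≠ 0` (`F_N(p) = trigPolySymbol (stencil (d+1)) pieceMatrix p`), the column
  `i ↦ fibInv N i j p` of `GAN24/CombesThomasFibre` solves the fibre system with unit right-hand side `e_j` — leaf-05's
  `fibreFun_fibInvCol` with (U1) in place of real-`p` bijectivity.
* **`fibInv_inl_inr_of_det`** — THE MINIMISER COLUMN (multiplier source `e_{(Q,l)}`, field reading at the fine site `(κ, z)`):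
  if moreover every alias Laplacian symbol `L_m(p) = lapSym (kFine p m)` is nonzero, then for SOME gauge constant `c`
  (i) `(φ, c)` with `φ κ′ = fibInv N (inr (inr κ′)) (inr (inr l)) p` (the MULTIPLIER–MULTIPLIER entries of the SAME column = the
  K-slot's mm currency `wΦ̂`) solves leaf-15's capacitance system with sources `(0, 0, 0, e_l)`, and
  (ii) `fibInv N (inl (κ, z)) (inr (inr l)) p = Σ_m Ablk (aliasFibre p hL) 0 0 φ c m κ · pw (kFine p m) (repZ z)` — the point value is
  the plane-wave synthesis of the per-alias amplitudes, and by `Ablk_border` each amplitude is leaf-02's EXPLICIT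
  `Asol (∂̂_m) (∂̂♭_m) (χ̂_m s♭(m) ⊙ φ) (L_m) (χ̂_m c)` (border feed only: no per-alias force, no G-source).
  (`Capacitance.cap_solution` — which needs neither unitarity of the Bloch character nor `det ≠ 0` — applied to the column; the
  uniqueness half of leaf-06's `bordered_inverse` is not needed and not used.)
* `Ablk_border`: `Ablk F 0 0 φ c m κ = Asol (F.dd m) (F.db m) (fun κ ↦ F.wE m κ * φ κ) (F.L m) (F.wG m * c) κ` (unfolding).
CAVEAT (design note §3): `hL` fails at `p = 0 ∈ Strip` (`L_0(0) = 0`); a sup bound over the strip is taken on `Strip ∖ {L_0 = 0}` and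
extended by continuity (`StripRegularPackaging.stripHolo_fibInv`), or the `m = 0` alias is handled by the scaled ℓ² bound (§2(a) there).
Unit `b2b-balaban-gan24-formalise-leaf-16` (G-an2-4 formalisation swarm, leaf prover 16, gen 8; records — idle-seat engine), 2026-08-20.
-/

noncomputable section

open Complex Finset
open scoped BigOperators Matrix
open Literature.MathematicalPhysics.QuantumFieldTheory.Balaban1983to89
open Literature.MathematicalPhysics.QuantumFieldTheory.Balaban1983to89.Beta
open Literature.MathematicalPhysics.QuantumFieldTheory.LatticeForm (repZ)
open Literature.Probability.LatticeModels (TorusSite)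
open BlochFibreMatrix (Idx blochChar fibreFun fibreMatrix stencil pieceMatrix fibreMatrix_mulVec fibreMatrix_blochChar_eq_trigPolySymbol)
open FibreInverseDecay (trigPolySymbol)
open Summit.QuantumFields.BalabanUV.Beta.GAN24.FibreSymbols (pw lapSym)
open Summit.QuantumFields.BalabanUV.Beta.GAN24.FibreDFT (kFine)
open Summit.QuantumFields.BalabanUV.Beta.GAN24.FibreDFTDictionary (ampA boxData_inl_eq_sum)
open Summit.QuantumFields.BalabanUV.Beta.GAN24.FibreBlockSolve (Asol)
open Summit.QuantumFields.BalabanUV.Beta.GAN24.CapacitanceSolve (Fibre CapSolves Ablk feed gfeed)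
open Summit.QuantumFields.BalabanUV.Beta.GAN24.FibreArrow (srcEL srcG aliasFibre)
open Summit.QuantumFields.BalabanUV.Beta.GAN24.Capacitance (cap_solution)
open Summit.QuantumFields.BalabanUV.Beta.GAN24.CombesThomasFibre (fibInv)
open Summit.QuantumFields.BalabanUV.Beta.GAN24.FibInvClosedForm (fibInvCol_eq_mulVec_single srcEL_single_inr srcG_single_inr
  single_inr_M single_inr_Q)

namespace Summit.QuantumFields.BalabanUV.Beta.GAN24.FineReadoutColumn

/-! ## §1 The per-alias amplitude with border feed only -/

section Border

variable {D : ℕ} {ι : Type*} (F : Fibre D ι)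

/-- [folklore] With no per-alias force and no G-source the per-alias amplitude is `Asol` fed by the border alone:
`Ablk F 0 0 φ c m = Asol (∂̂_m) (∂̂♭_m) (wE_m ⊙ φ) (L_m) (wG_m · c)`. -/
theorem Ablk_border (φ : Fin D → ℂ) (c : ℂ) (m : ι) :
    Ablk F 0 0 φ c m = Asol (F.dd m) (F.db m) (fun κ => F.wE m κ * φ κ) (F.L m) (F.wG m * c) := by
  unfold Ablk feed gfeed
  simp only [Pi.zero_apply, zero_add]

end Border

/-! ## §2 The column of the inverse fibre at a complex quasi-momentum with nonzero determinant -/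

section Column

variable {d N : ℕ} [NeZero N]

/-- [folklore] **`det F_N(p) ≠ 0` ⇒ THE COLUMN `j` OF `fibInv` SOLVES THE FIBRE SYSTEM WITH UNIT RIGHT-HAND SIDE `e_j`**, at ANY complex `p`
(leaf-05's `fibreFun_fibInvCol` with (U1) replacing real-`p` bijectivity). -/
theorem fibreFun_fibInvCol_of_det (p : Fin (d + 1) → ℂ)
    (hdet : (trigPolySymbol (stencil (d + 1)) (pieceMatrix (N := N)) p).det ≠ 0) (j : Idx (d + 1) N) :
    fibreFun (⇑(blochChar p)) (fun i => fibInv N i j p) = Pi.single j 1 := by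
  have hU : IsUnit (fibreMatrix (N := N) (⇑(blochChar p))).det := by
    rw [fibreMatrix_blochChar_eq_trigPolySymbol]; exact hdet.isUnit
  rw [← fibreMatrix_mulVec, fibInvCol_eq_mulVec_single, Matrix.mulVec_mulVec, Matrix.mul_nonsing_inv _ hU, Matrix.one_mulVec]

/-- [folklore] **THE MINIMISER COLUMN, EXPLICIT ALIAS BY ALIAS, AT A COMPLEX QUASI-MOMENTUM.**  If `det F_N(p) ≠ 0` and every alias
Laplacian symbol `L_m(p)` is nonzero, then for some gauge constant `c`: the multiplier–multiplier entries `φ κ′ = fibInv N (inr (inr κ′)) (inr (inr l)) p`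
of the column together with `c` solve the capacitance system with sources `(0, 0, 0, e_l)`, and every FIELD entry of the column is the plane-wave
synthesis of the per-alias amplitudes `Ablk (aliasFibre p hL) 0 0 φ c m` (= `Asol` with border feed, `Ablk_border`). -/
theorem fibInv_inl_inr_of_det (p : Fin (d + 1) → ℂ)
    (hdet : (trigPolySymbol (stencil (d + 1)) (pieceMatrix (N := N)) p).det ≠ 0)
    (hL : ∀ m : TorusSite (d + 1) N, lapSym (kFine p m) ≠ 0) (l : Fin (d + 1)) :
    ∃ c : ℂ,
      CapSolves (aliasFibre p hL) 0 0 0 (fun κ => if κ = l then (1 : ℂ) else 0)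
        (fun κ' => fibInv N (Sum.inr (Sum.inr κ')) (Sum.inr (Sum.inr l)) p) c ∧
      ∀ (κ : Fin (d + 1)) (z : TorusSite (d + 1) N),
        fibInv N (Sum.inl (κ, z)) (Sum.inr (Sum.inr l)) p
          = ∑ m : TorusSite (d + 1) N,
              Ablk (aliasFibre p hL) 0 0 (fun κ' => fibInv N (Sum.inr (Sum.inr κ')) (Sum.inr (Sum.inr l)) p) c m κ
                * pw (kFine p m) (repZ z) := by
  set v : Idx (d + 1) N → ℂ := fun i => fibInv N i (Sum.inr (Sum.inr l)) p with hv_def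
  have hv : fibreFun (⇑(blochChar p)) v = Pi.single (Sum.inr (Sum.inr l)) 1 := fibreFun_fibInvCol_of_det p hdet _
  obtain ⟨c, hcap, hA, -⟩ := cap_solution p hL v
  rw [hv, srcEL_single_inr, srcG_single_inr, single_inr_M] at hcap
  rw [hv, srcEL_single_inr, srcG_single_inr] at hA
  have hQ : (fun κ => Pi.single (M := fun _ : Idx (d + 1) N => ℂ) (Sum.inr (Sum.inr l)) (1 : ℂ) (Sum.inr (Sum.inr κ)))
      = fun κ => if κ = l then (1 : ℂ) else 0 := by
    funext κ; exact single_inr_Q l κ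
  rw [hQ] at hcap
  refine ⟨c, hcap, fun κ z => ?_⟩
  have h := boxData_inl_eq_sum p v κ z
  rw [hA] at h
  exact h

/-- [folklore] The same with the amplitude written as leaf-02's `Asol` with border feed (`χ̂_m s♭_κ(m) φ_κ`, gauge feed `χ̂_m c`). -/
theorem fibInv_inl_inr_eq_sum_Asol (p : Fin (d + 1) → ℂ)
    (hdet : (trigPolySymbol (stencil (d + 1)) (pieceMatrix (N := N)) p).det ≠ 0)
    (hL : ∀ m : TorusSite (d + 1) N, lapSym (kFine p m) ≠ 0) (l : Fin (d + 1)) :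
    ∃ c : ℂ,
      CapSolves (aliasFibre p hL) 0 0 0 (fun κ => if κ = l then (1 : ℂ) else 0)
        (fun κ' => fibInv N (Sum.inr (Sum.inr κ')) (Sum.inr (Sum.inr l)) p) c ∧
      ∀ (κ : Fin (d + 1)) (z : TorusSite (d + 1) N),
        fibInv N (Sum.inl (κ, z)) (Sum.inr (Sum.inr l)) p
          = ∑ m : TorusSite (d + 1) N,
              Asol ((aliasFibre p hL).dd m) ((aliasFibre p hL).db m)
                  (fun κ' => (aliasFibre p hL).wE m κ' * fibInv N (Sum.inr (Sum.inr κ')) (Sum.inr (Sum.inr l)) p)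
                  ((aliasFibre p hL).L m) ((aliasFibre p hL).wG m * c) κ
                * pw (kFine p m) (repZ z) := by
  obtain ⟨c, hcap, h⟩ := fibInv_inl_inr_of_det p hdet hL l
  refine ⟨c, hcap, fun κ z => ?_⟩
  rw [h κ z]
  exact Finset.sum_congr rfl fun m _ => by rw [Ablk_border]

end Column

end Summit.QuantumFields.BalabanUV.Beta.GAN24.FineReadoutColumn

end
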